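import Summits.BirchSwinnertonDyer.Rank1Residual.Iwasawa.CyclotomicLayerOneCubic
import Summits.BirchSwinnertonDyer.Rank1Residual.Iwasawa.LayerOneRankCertificate
import Summits.BirchSwinnertonDyer.Rank1Residual.Additive.X3BranchKummerLayerClasses
import Literature.NumberTheory.NumberFields.CubicFieldDedekindKummer
import HarnessLib

/-!
# X3, the DEGENERATE rows OFF the sub-locus: the first layer `ℚ_1 = ℚ(θ)`, `θ = ζ₉ + ζ₉⁻¹`, as a
# field of coefficients — the minimal polynomial `X³ − 3X + 1`, transfer of identities in `θ` to
# identities modulo `q` at a root of `X³ − 3X + 1 (mod q)`, and «fixed by `Gal(ℚ̄/ℚ_1)` ⟹ a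
# `ℚ`-combination of `1, θ, θ²`» (cell `bsd-eis`, seat `bsd-eis-x3` gen 7; sequel of k5-c3's
# `Iwasawa/CyclotomicLayerOneCubic.lean` and of `X3BranchKummerLayerClasses.lean`; route K1
# `AdditiveBranchIMC`, crux `GordTwoRankZeroOffCaseOne` — supports only)

HONEST FRAMING (cell `bsd-eis`, `run/shared/lean/pub/bsd-eis/README.md` §4): the programme's target of
record is the full Birch–Swinnerton-Dyer formula for every `E/ℚ` of analytic rank `≤ 1`; this file is
field theory for the U-side LOWER BOUND of the degenerate certificate road on the rows with a prime
`ℓ ≡ ±1 (mod 9)` in `Σ₀` (x3-MEMO-9 §2.4 (e)): the independence of the exhibited Kummer classes is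
certified by CUBIC RESIDUES of the units `a_i = P_i(θ)` at auxiliary primes `q ≡ 1 (mod 9)`, which
needs (i) `P(θ) = 0 ⟹ X³ − 3X + 1 ∣ P` in `ℤ[X]` ⟹ `P(r) ≡ 0 (mod q)` at every root `r` of the cubic
modulo `q`, and (ii) an element of `ℚ̄` fixed by `Gal(ℚ̄/ℚ_1) = κ⁻¹(3ℤ₃)` is `(g₀ + g₁θ + g₂θ²)/m`.
THEOREMS ONLY (no `def`, no named fact, no `sorry`); nothing is booked; no label or count moves.

* §1 (irreducibility of `X³ − 3X + 1` is k5-c3's `LayerOneRank.irreducible_polyQ`) `aeval_poly_eq_zero`,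
  `minpoly_rat_theta`, `minpoly_int_theta`, `poly_dvd_of_aeval_eq_zero`,
  `eval_intCast_eq_of_aeval_eq` (the transfer to `ZMod q`).
* §2 `adjoin_theta_eq_layer_one` (`ℚ⟮θ⟯ = κ.layer 1`, both of degree `3`),
  `exists_intCombination_of_fixed` (`γ` fixed by `κ⁻¹(3ℤ₃)` ⟹ `m·γ = g₀ + g₁θ + g₂θ²`, `m ≥ 1`).

References: [Washington1997] §13.1; [Marcus2018] Ch. 3 Thm. 27 (method); cell file
`run/shared/lean/pub/bsd-eis/x3-MEMO-9.md` §2.4.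
-/

set_option autoImplicit false

noncomputable section

open scoped Classical NumberField

namespace Summit.BirchSwinnertonDyer.Rank1Residual.Additive

namespace KummerLayerClasses

open Field Polynomial IntermediateField
  Literature.NumberTheory.GaloisRepresentations
  Literature.NumberTheory.EllipticCurves
  Literature.NumberTheory.NumberFields
  Summit.BirchSwinnertonDyer.Rank1Residual.Iwasawa.CyclotomicLayerOne

/-! ### §1 The cubic `X³ − 3X + 1` as a minimal polynomial; transfer of identities modulo `q` -/

/-- A root of `θ³ = 3θ − 1` is a root of `MonicCubic.poly 0 (-3) 1 = X³ − 3X + 1`. [folklore] -/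
theorem aeval_poly_eq_zero {F : Type*} [Field F] {θ : F} (hθ : θ ^ 3 = 3 * θ - 1) :
    aeval θ (MonicCubic.poly 0 (-3) 1) = 0 := by
  simp only [MonicCubic.poly, map_add, map_mul, map_pow, aeval_X, aeval_C]
  simp only [eq_intCast, Int.cast_zero, Int.cast_one, Int.cast_neg, Int.cast_ofNat]
  linear_combination hθ

/-- The minimal polynomial over `ℚ` of `θ` (`θ³ = 3θ − 1`) is `X³ − 3X + 1`. [folklore] -/
theorem minpoly_rat_theta {F : Type*} [Field F] [Algebra ℚ F] {θ : F} (hθ : θ ^ 3 = 3 * θ - 1) :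
    minpoly ℚ θ = MonicCubic.polyQ 0 (-3) 1 :=
  (minpoly.eq_of_irreducible_of_monic Summit.BirchSwinnertonDyer.Rank1Residual.Iwasawa.LayerOneRank.irreducible_polyQ
    (by rw [MonicCubic.polyQ, aeval_map_algebraMap]; exact aeval_poly_eq_zero hθ)
    (MonicCubic.monic_polyQ 0 (-3) 1)).symm

/-- The minimal polynomial over `ℤ` of `θ` (`θ³ = 3θ − 1`) is `X³ − 3X + 1`. [folklore] -/
theorem minpoly_int_theta {F : Type*} [Field F] [CharZero F] {θ : F} (hθ : θ ^ 3 = 3 * θ - 1) :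
    minpoly ℤ θ = MonicCubic.poly 0 (-3) 1 := by
  apply Polynomial.map_injective (algebraMap ℤ ℚ) (algebraMap ℤ ℚ).injective_int
  letI : Algebra ℚ F := DivisionRing.toRatAlgebra
  rw [← minpoly.isIntegrallyClosed_eq_field_fractions' ℚ
    (MonicCubic.isIntegral_of_aeval (aeval_poly_eq_zero hθ)), minpoly_rat_theta hθ]
  rfl

/-- **`P(θ) = 0` with `P ∈ ℤ[X]` forces `X³ − 3X + 1 ∣ P` in `ℤ[X]`** (`ℤ` integrally closed, Gauss).
[folklore] -/
theorem poly_dvd_of_aeval_eq_zero {F : Type*} [Field F] [CharZero F] {θ : F} (hθ : θ ^ 3 = 3 * θ - 1)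
    {P : ℤ[X]} (hP : aeval θ P = 0) : MonicCubic.poly 0 (-3) 1 ∣ P := by
  rw [← minpoly_int_theta hθ]
  exact minpoly.isIntegrallyClosed_dvd (MonicCubic.isIntegral_of_aeval (aeval_poly_eq_zero hθ)) hP

/-- **Transfer modulo `q`**: if `P(θ) = Q(θ)` in a field of characteristic `0` (`θ³ = 3θ − 1`,
`P, Q ∈ ℤ[X]`) and `r³ − 3r + 1 = 0` in a commutative ring `S` (e.g. `S = ℤ/q`, `r` a root of the
cubic mod `q`), then `P(r) = Q(r)` in `S`. [folklore] -/
theorem eval₂_eq_of_aeval_eq {F : Type*} [Field F] [CharZero F] {θ : F} (hθ : θ ^ 3 = 3 * θ - 1)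
    {P Q : ℤ[X]} (h : aeval θ P = aeval θ Q) {S : Type*} [CommRing S] (r : S)
    (hr : r ^ 3 - 3 * r + 1 = 0) :
    P.eval₂ (Int.castRingHom S) r = Q.eval₂ (Int.castRingHom S) r := by
  have h0 : aeval θ (P - Q) = 0 := by rw [map_sub, h, sub_self]
  obtain ⟨W, hW⟩ := poly_dvd_of_aeval_eq_zero hθ h0
  have hf : (MonicCubic.poly 0 (-3) 1).eval₂ (Int.castRingHom S) r = 0 := by
    simp only [MonicCubic.poly, eval₂_add, eval₂_mul, eval₂_X_pow, eval₂_C, eval₂_X]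
    simp only [eq_intCast, Int.cast_zero, Int.cast_one, Int.cast_neg, Int.cast_ofNat]
    linear_combination hr
  have e : (P - Q).eval₂ (Int.castRingHom S) r = 0 := by rw [hW, eval₂_mul, hf, zero_mul]
  rwa [eval₂_sub, sub_eq_zero] at e

/-! ### §2 `ℚ⟮θ⟯` is the first layer; its elements -/

/-- `[ℚ⟮θ⟯ : ℚ] = 3` for `θ³ = 3θ − 1` in `ℚ̄`. [folklore] -/
theorem finrank_adjoin_theta {θ : AlgebraicClosure ℚ} (hθ : θ ^ 3 = 3 * θ - 1) :
    Module.finrank ℚ ℚ⟮θ⟯ = 3 := by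
  have hint : IsIntegral ℚ θ := (MonicCubic.isIntegral_of_aeval (aeval_poly_eq_zero hθ)).tower_top
  rw [adjoin.finrank hint, minpoly_rat_theta hθ, MonicCubic.natDegree_polyQ]

/-- **`ℚ⟮θ⟯ = ℚ_1`**: for a cyclotomic `κ : ZpExtension ℚ 3` and `θ = ζ + ζ⁸` (`ζ` a primitive `9`-th
root of unity) the first layer `κ.layer 1` is `ℚ⟮θ⟯` — `θ ∈ κ.layer 1` (k5-c3's
`zeta_add_pow_mem_layer_one`) and both have degree `3`. [cite: Washington1997, §13.1] -/
theorem adjoin_theta_eq_layer_one {κ : ZpExtension ℚ 3} (hκ : κ.IsCyclotomic)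
    {ζ : AlgebraicClosure ℚ} (hζ : IsPrimitiveRoot ζ 9) : ℚ⟮ζ + ζ ^ 8⟯ = κ.layer 1 := by
  have hθ : (ζ + ζ ^ 8) ^ 3 = 3 * (ζ + ζ ^ 8) - 1 := by linear_combination theta_cubic hζ
  have hle : ℚ⟮ζ + ζ ^ 8⟯ ≤ κ.layer 1 :=
    adjoin_simple_le_iff.mpr (zeta_add_pow_mem_layer_one hκ ζ hζ.pow_eq_one)
  haveI : FiniteDimensional ℚ (κ.layer 1) := κ.finiteDimensional_layer_holds 1
  have h3 : Module.finrank ℚ (κ.layer 1) = 3 ^ 1 := κ.finrank_layer_holds 1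
  refine eq_of_le_of_finrank_eq hle ?_
  rw [finrank_adjoin_theta hθ]
  exact (h3.trans (pow_one 3)).symm

/-- **An element of `ℚ̄` fixed by `Gal(ℚ̄/ℚ_1) = κ⁻¹(3ℤ₃)` is `(g₀ + g₁θ + g₂θ²)/m`** with `g ∈ ℤ³`,
`m ≥ 1` (`θ = ζ + ζ⁸`): it lies in the fixed field `κ.layer 1 = ℚ⟮θ⟯ = ℚ[θ]`, whose elements are
values at `θ` of rational polynomials of degree `≤ 2` (reduction modulo the minimal polynomial),
and denominators are cleared. [cite: Washington1997, §13.1] -/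
theorem exists_intCombination_of_fixed {κ : ZpExtension ℚ 3} (hκ : κ.IsCyclotomic)
    {ζ : AlgebraicClosure ℚ} (hζ : IsPrimitiveRoot ζ 9) {γ : AlgebraicClosure ℚ}
    (hγ : ∀ σ ∈ κ.layerSubgroup 1, σ • γ = γ) :
    ∃ (m : ℕ) (g₀ g₁ g₂ : ℤ), 0 < m ∧
      (m : AlgebraicClosure ℚ) * γ = g₀ + g₁ * (ζ + ζ ^ 8) + g₂ * (ζ + ζ ^ 8) ^ 2 := by
  set θ := ζ + ζ ^ 8 with hθdef
  have hθ : θ ^ 3 = 3 * θ - 1 := by linear_combination theta_cubic hζ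
  have hint : IsIntegral ℚ θ := (MonicCubic.isIntegral_of_aeval (aeval_poly_eq_zero hθ)).tower_top
  -- `γ ∈ κ.layer 1 = ℚ⟮θ⟯`
  have hmem : γ ∈ κ.layer 1 := by
    rw [ZpExtension.layer, IntermediateField.mem_fixedField_iff]
    intro g hg
    obtain ⟨σ, hσ, rfl⟩ := Subgroup.mem_map.mp hg
    exact hγ σ hσ
  rw [← adjoin_theta_eq_layer_one hκ hζ] at hmem
  -- `γ = p(θ)` with `p ∈ ℚ[X]`, `deg p < 3`
  have hmem' : γ ∈ (ℚ⟮θ⟯).toSubalgebra := hmem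
  rw [adjoin_simple_toSubalgebra_of_isAlgebraic hint.isAlgebraic,
    Algebra.adjoin_singleton_eq_range_aeval] at hmem'
  obtain ⟨p, hp⟩ := hmem'
  set p' := p %ₘ minpoly ℚ θ with hp'
  have hp'eval : aeval θ p' = γ := by
    rw [hp', aeval_modByMonic_eq_self_of_root (minpoly.aeval ℚ θ), ← hp]
    rfl
  have hdeg : p'.natDegree < 3 := by
    rw [hp', minpoly_rat_theta hθ]
    have h := natDegree_modByMonic_lt p (MonicCubic.monic_polyQ 0 (-3) 1)
      (fun h1 ↦ by have := congrArg natDegree h1; rw [MonicCubic.natDegree_polyQ] at this; simp at this)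
    rwa [MonicCubic.natDegree_polyQ] at h
  -- write `p' = c₀ + c₁ X + c₂ X²`
  have hp'eq : p' = C (p'.coeff 0) + C (p'.coeff 1) * X + C (p'.coeff 2) * X ^ 2 := by
    refine Polynomial.ext fun n ↦ ?_
    simp only [coeff_add, coeff_C, coeff_C_mul_X, coeff_C_mul_X_pow]
    rcases n with _ | _ | _ | n
    · simp
    · simp
    · simp
    · have : p'.coeff (n + 3) = 0 := coeff_eq_zero_of_natDegree_lt (by omega)
      simp [this]
  -- clear denominators
  set c₀ := p'.coeff 0
  set c₁ := p'.coeff 1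
  set c₂ := p'.coeff 2
  set m : ℕ := c₀.den * c₁.den * c₂.den with hm
  have hm0 : 0 < m := by positivity
  have hγ' : γ = (c₀ : AlgebraicClosure ℚ) + (c₁ : AlgebraicClosure ℚ) * θ +
      (c₂ : AlgebraicClosure ℚ) * θ ^ 2 := by
    rw [← hp'eval, hp'eq]
    simp [map_add, map_mul, map_pow, aeval_X, aeval_C]
  -- the integers `g_i = m c_i`
  have hg₀ : ((c₀.num * c₁.den * c₂.den : ℤ) : ℚ) = (m : ℚ) * c₀ := by
    rw [hm]; push_cast; linear_combination (-(c₁.den : ℚ) * c₂.den) * Rat.mul_den_eq_num c₀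
  have hg₁ : ((c₁.num * c₀.den * c₂.den : ℤ) : ℚ) = (m : ℚ) * c₁ := by
    rw [hm]; push_cast; linear_combination (-(c₀.den : ℚ) * c₂.den) * Rat.mul_den_eq_num c₁
  have hg₂ : ((c₂.num * c₀.den * c₁.den : ℤ) : ℚ) = (m : ℚ) * c₂ := by
    rw [hm]; push_cast; linear_combination (-(c₀.den : ℚ) * c₁.den) * Rat.mul_den_eq_num c₂
  have cast₀ : ((c₀.num * c₁.den * c₂.den : ℤ) : AlgebraicClosure ℚ) =
      (m : AlgebraicClosure ℚ) * (c₀ : AlgebraicClosure ℚ) := by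
    rw [← Rat.cast_intCast (α := AlgebraicClosure ℚ), hg₀]; push_cast; ring
  have cast₁ : ((c₁.num * c₀.den * c₂.den : ℤ) : AlgebraicClosure ℚ) =
      (m : AlgebraicClosure ℚ) * (c₁ : AlgebraicClosure ℚ) := by
    rw [← Rat.cast_intCast (α := AlgebraicClosure ℚ), hg₁]; push_cast; ring
  have cast₂ : ((c₂.num * c₀.den * c₁.den : ℤ) : AlgebraicClosure ℚ) =
      (m : AlgebraicClosure ℚ) * (c₂ : AlgebraicClosure ℚ) := by
    rw [← Rat.cast_intCast (α := AlgebraicClosure ℚ), hg₂]; push_cast; ring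
  refine ⟨m, c₀.num * c₁.den * c₂.den, c₁.num * c₀.den * c₂.den, c₂.num * c₀.den * c₁.den, hm0, ?_⟩
  rw [cast₀, cast₁, cast₂, hγ']
  ring

end KummerLayerClasses

end Summit.BirchSwinnertonDyer.Rank1Residual.Additive

end
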